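import Summits.ResolutionOfSingularities.ResolutionOfSingularities.Theorems.BoundaryLedgerModel
import HarnessLib

/-!
# BoundaryLedgerClasses — the pieces, THE ONE EQUIV and the laws of the node «BoundaryLedger» (§§4–6)
(decomp-res node N58, lens-3 g11 sha256 d8eb129300d19b44; CRITIC-LEDGER line 94 CLEARED AS DECISION NODE; file 2 of 3, namespace
`…Theorems.BoundaryLedger` continued from `Theorems.BoundaryLedgerModel`, whose module docstring is the node's card.)

§4: `NoCriticalFreePlateauxDeep` [UNDECIDED; = `NoBareTailsDeep` (ρ = 0, KNOWN-MOD-PORT CJS2020 Cor. 5.37) ∧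
`NoLoadedCriticalPlateauxDeep` (1 ≤ ρ < q, ATTACKABLE), `critical_iff_bare_loaded`],
`SatDefectWalksTerminateDeep` [THE residual];
THE ONE EQUIV `defectDeep_iff_ledger : DefectWalksTerminateDeep ⟺ NoCriticalFreePlateauxDeep ∧
SatDefectWalksTerminateDeep` (PROVED via
`free_tail_rigid`); the decided cells `noFreeJumpWalksDeep_holds`, `freeTailsAreCriticalDeep_holds`; the 2 × 2 grid
with the itinerary
cut (`noRecurrentJump_of_satDeep`, `critical_of_noPlateau`, `defectDeep_iff_plateau_sat`).  §5: `ledger_step`,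
`degree_le_of_walk`,
MEAN REVERSION `exists_shade_le_within`, `not_eventually_supercritical`, `free_stretch_law`.  §6:
`polyPureTowersTerminateDeep_of_ledger`.
The MaxContactCut-side edge `defectWalksDeep_iff_ledger` is in `Theorems.MaxContactCutBoundaryLedger`.
(Sources: CossartJannsenSaito2020 Def. 5.34, Thm. 5.35, Cor. 5.37, §9; Hauser2010 §G; Moh1987; BenitoVillamayor2013 §7.)
-/

open MvPolynomial
open Literature.AlgebraicGeometry.Resolution
open Literature.AlgebraicGeometry.Resolution.Hauser2010
open Literature.AlgebraicGeometry.Resolution.PointBlowup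
open Summit.ResolutionOfSingularities.ResolutionOfSingularities.Theorems.TightDefectClasses
open Summit.ResolutionOfSingularities.ResolutionOfSingularities.Theorems.TightDefectStrongWalks
open Summit.ResolutionOfSingularities.ResolutionOfSingularities.Theorems.ItineraryCutClasses

namespace Summit.ResolutionOfSingularities.ResolutionOfSingularities.Theorems.BoundaryLedger

/-! ## §4 The pieces and the ONE EQUIV -/

/-- **`NoCriticalFreePlateauxDeep`** — no infinite forced deep walk (`q = pᵉ`, `e ≥ 2`, positive shade) ends in a
CRITICAL FREE PLATEAU: from some time on no satellite moves, shade exactly `q`, constant boundary mass `ρ`.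
[UNDECIDED · WEAKER (`critical_of_deep`; the satellite-recurrent class is separated off) · refined below into
BARE (ρ = 0, KNOWN-MOD-PORT `BareTailPort`) and LOADED (ρ ≥ 1, ATTACKABLE) · INSTRUMENTABLE T-ledger]
(Sources: CJS2020 Cor. 5.37; Hauser2010 §G; Moh1987.) -/
def NoCriticalFreePlateauxDeep : Prop :=
  ∀ p : ℕ, p.Prime → ∀ e : ℕ, 2 ≤ e → ∀ (K : Type) [Field K] [CharP K p] [PerfectField K] [DecidableEq K]
    (s₀ : State (Fin 3) K), IsRoot (p ^ e) s₀ → ∀ W : ForcedWalk (p ^ e) s₀, (∀ i, 1 ≤ (W.st i).shade) →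
    ∀ N ρ : ℕ, (∀ t, N ≤ t → ¬ W.Satellite t ∧ (W.st t).shade = ((p ^ e : ℕ) : ℕ∞) ∧ (W.st t).r.degree = ρ) →
    False

/-- **`SatDefectWalksTerminateDeep`** — no infinite forced deep walk with positive shade makes satellite moves at
infinitely many times: the `e ≥ 2` copy of the tree's `SatDefectWalksTerminate` (30256 side), and after this node
THE residual of the E-format column.  Ledger constraints PROVED on it: `Σ κ_t = ∞`, every jump is a child of one
of its satellite moves (`satellite_of_jump_succ`), mean reversion of the shade (`exists_shade_le_within`).
[UNDECIDED · WEAKER (`satDeep_of_deep`) · IDEA-NEEDED · INSTRUMENTABLE T-sat]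
(Sources: Hauser2010 §G; HauserPerlega2019; BenitoVillamayor2013 §7.) -/
def SatDefectWalksTerminateDeep : Prop :=
  ∀ p : ℕ, p.Prime → ∀ e : ℕ, 2 ≤ e → ∀ (K : Type) [Field K] [CharP K p] [PerfectField K] [DecidableEq K]
    (s₀ : State (Fin 3) K), IsRoot (p ^ e) s₀ → ∀ W : ForcedWalk (p ^ e) s₀, (∀ i, 1 ≤ (W.st i).shade) →
    (∀ N : ℕ, ∃ i, N ≤ i ∧ W.Satellite i) → False

/-- **`NoBareTailsDeep`** — the BARE critical cell (ρ = 0): no infinite forced deep walk is eventually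
boundary-free of order exactly `q` (`r_t = 0`, `o_t = q` for all large `t`).  Geometrically: an infinite sequence
of closed-point blowups of the hypersurface `Z^q + F_t` at K-rational points of multiplicity `q`, isolated in the
multiplicity-`q` locus, with `ord F_t = q` throughout — the `e_x = 1` regime of Cossart–Jannsen–Saito.
[KNOWN-MOD-PORT `BareTailPort` (CJS2020 Cor. 5.37 with Thm. 2.14 / 4.20, Def. 5.34, B = ∅) · WEAKER]
(Sources: CJS2020 Cor. 5.37, Thm. 9.2; CossartPiltant2019.) -/
def NoBareTailsDeep : Prop :=
  ∀ p : ℕ, p.Prime → ∀ e : ℕ, 2 ≤ e → ∀ (K : Type) [Field K] [CharP K p] [PerfectField K] [DecidableEq K]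
    (s₀ : State (Fin 3) K), IsRoot (p ^ e) s₀ → ∀ W : ForcedWalk (p ^ e) s₀, (∀ i, 1 ≤ (W.st i).shade) →
    ∀ N : ℕ, (∀ t, N ≤ t → (W.st t).r = 0 ∧ ordZero (W.st t).F = ((p ^ e : ℕ) : ℕ∞)) → False

/-- **`NoLoadedCriticalPlateauxDeep`** — the LOADED critical cell (ρ ≥ 1): no infinite forced deep walk ends in a
free plateau of shade `q` dragging one exceptional component of constant multiplicity `ρ ∈ [1, q)` (order
`q + ρ`; tangent cone `Z^q`, so CJS's `e_x = 1` theory does not apply verbatim: the residual `u^{-ρ}·in(F_t)` is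
the binary form, twisted by units at each free move).
[UNDECIDED · WEAKER · ATTACKABLE (unit-twisted `e = 1` δ-invariant) · INSTRUMENTABLE T-ledger]
(Sources: CJS2020 §9; BenitoVillamayor2013 §7; KangPerry2024.) -/
def NoLoadedCriticalPlateauxDeep : Prop :=
  ∀ p : ℕ, p.Prime → ∀ e : ℕ, 2 ≤ e → ∀ (K : Type) [Field K] [CharP K p] [PerfectField K] [DecidableEq K]
    (s₀ : State (Fin 3) K), IsRoot (p ^ e) s₀ → ∀ W : ForcedWalk (p ^ e) s₀, (∀ i, 1 ≤ (W.st i).shade) →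
    ∀ N ρ : ℕ, 1 ≤ ρ →
    (∀ t, N ≤ t → ¬ W.Satellite t ∧ (W.st t).shade = ((p ^ e : ℕ) : ℕ∞) ∧ (W.st t).r.degree = ρ) → False

/-! ### Necessity of every piece from the blocker (no piece is stronger than `DefectWalksTerminateDeep`) -/

/-- Necessity of the critical-plateau piece from the blocker. [folklore] -/
theorem critical_of_deep (h : DefectWalksTerminateDeep) : NoCriticalFreePlateauxDeep :=
  fun p hp e he K _ _ _ _ s₀ hs W hpos _ _ _ => h p hp e he K s₀ hs W hpos

/-- Necessity of the satellite piece from the blocker. [folklore] -/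
theorem satDeep_of_deep (h : DefectWalksTerminateDeep) : SatDefectWalksTerminateDeep :=
  fun p hp e he K _ _ _ _ s₀ hs W hpos _ => h p hp e he K s₀ hs W hpos

/-- Necessity of the bare piece from the blocker. [folklore] -/
theorem bare_of_deep (h : DefectWalksTerminateDeep) : NoBareTailsDeep :=
  fun p hp e he K _ _ _ _ s₀ hs W hpos _ _ => h p hp e he K s₀ hs W hpos

/-- Necessity of the loaded piece from the blocker. [folklore] -/
theorem loaded_of_deep (h : DefectWalksTerminateDeep) : NoLoadedCriticalPlateauxDeep :=
  fun p hp e he K _ _ _ _ s₀ hs W hpos _ _ _ _ => h p hp e he K s₀ hs W hpos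

/-! ### The DECIDED cells of the grid (PROVED outright, no port) -/

/-- **`NoFreeJumpWalksDeep`** — the cell (recurrent jumps) × (eventually free) of the grid itinerary × boundary: no
infinite forced deep walk with positive shade is eventually free AND jumps at infinitely many times.
[DECIDED · PROVED (`noFreeJumpWalksDeep_holds`, kernel `satellite_of_jump_succ`)] (Sources: Hauser2010 §G.) -/
def NoFreeJumpWalksDeep : Prop :=
  ∀ p : ℕ, p.Prime → ∀ e : ℕ, 2 ≤ e → ∀ (K : Type) [Field K] [CharP K p] [PerfectField K] [DecidableEq K]
    (s₀ : State (Fin 3) K), IsRoot (p ^ e) s₀ → ∀ W : ForcedWalk (p ^ e) s₀, (∀ i, 1 ≤ (W.st i).shade) →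
    (∃ N, ∀ t, N ≤ t → ¬ W.Satellite t) → RecurrentJumps (fun i => (W.st i).shade) → False

/-- [DECIDED · PROVED] [folklore] -/
theorem noFreeJumpWalksDeep_holds : NoFreeJumpWalksDeep :=
  fun _ hp _ _ _ _ _ _ _ _ hs W _ hfree hR => noFreeJumpWalks hp hs W hfree hR

/-- **`FreeTailsAreCriticalDeep`** — every infinite forced deep walk that is eventually free has shade EXACTLY `q`
and constant boundary mass `ρ < q` from some time on; equivalently the class «eventually free, and sub- or
super-critical (shade ≠ q) at infinitely many times» is EMPTY.
[DECIDED · PROVED (`freeTailsAreCriticalDeep_holds`, kernel `free_tail_rigid`)] (Sources: Hauser2010 §§D,G; Moh1987.) -/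
def FreeTailsAreCriticalDeep : Prop :=
  ∀ p : ℕ, p.Prime → ∀ e : ℕ, 2 ≤ e → ∀ (K : Type) [Field K] [CharP K p] [PerfectField K] [DecidableEq K]
    (s₀ : State (Fin 3) K), IsRoot (p ^ e) s₀ → ∀ W : ForcedWalk (p ^ e) s₀,
    (∃ N, ∀ t, N ≤ t → ¬ W.Satellite t) →
    ∃ N ρ : ℕ, ρ < p ^ e ∧ ∀ t, N ≤ t → (W.st t).shade = ((p ^ e : ℕ) : ℕ∞) ∧ (W.st t).r.degree = ρ

/-- [DECIDED · PROVED] [folklore] -/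
theorem freeTailsAreCriticalDeep_holds : FreeTailsAreCriticalDeep := by
  intro p hp e _ K _ _ _ _ s₀ hs W hfree
  obtain ⟨N, ρ, hρ, h⟩ := free_tail_rigid hp hs W hfree
  exact ⟨N, ρ, hρ, fun t ht => ⟨(h t ht).2.1, (h t ht).2.2.1⟩⟩

/-- The deep satellite piece is the `e ≥ 2` restriction of the tree's `SatDefectWalksTerminate` (BY NAME). [folklore] -/
theorem satDeep_of_sat (h : SatDefectWalksTerminate) : SatDefectWalksTerminateDeep :=
  fun p hp e he K _ _ _ _ s₀ hs W hpos hS => h p hp e (one_le_two.trans he) K s₀ hs W hpos hS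

/-- **The blocker from the two pieces (PROVED, kernel `free_tail_rigid`).** [folklore] -/
theorem deep_of_ledger (h₁ : NoCriticalFreePlateauxDeep) (h₂ : SatDefectWalksTerminateDeep) :
    DefectWalksTerminateDeep := by
  intro p hp e he K _ _ _ _ s₀ hs W hpos
  by_cases hS : ∀ N : ℕ, ∃ i, N ≤ i ∧ W.Satellite i
  · exact h₂ p hp e he K s₀ hs W hpos hS
  · push Not at hS
    obtain ⟨N, hN⟩ := hS
    obtain ⟨N₁, ρ, -, hrig⟩ := free_tail_rigid hp hs W ⟨N, fun t ht => hN t ht⟩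
    exact h₁ p hp e he K s₀ hs W hpos N₁ ρ fun t ht => ⟨(hrig t ht).1, (hrig t ht).2.1, (hrig t ht).2.2.1⟩

/-- **THE ONE EQUIV (PROVED): `DefectWalksTerminateDeep ⟺ NoCriticalFreePlateauxDeep ∧
SatDefectWalksTerminateDeep`.** [folklore] -/
theorem defectDeep_iff_ledger :
    DefectWalksTerminateDeep ↔ NoCriticalFreePlateauxDeep ∧ SatDefectWalksTerminateDeep :=
  ⟨fun h => ⟨critical_of_deep h, satDeep_of_deep h⟩, fun h => deep_of_ledger h.1 h.2⟩

/-- **The critical cell splits EXACTLY by the mass `ρ` (PROVED): bare (ρ = 0) and loaded (ρ ≥ 1).** [folklore] -/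
theorem critical_iff_bare_loaded :
    NoCriticalFreePlateauxDeep ↔ NoBareTailsDeep ∧ NoLoadedCriticalPlateauxDeep := by
  classical
  constructor
  · intro h
    refine ⟨fun p hp e he K _ _ _ _ s₀ hs W hpos N hB => ?_,
      fun p hp e he K _ _ _ _ s₀ hs W hpos N ρ _ hC => h p hp e he K s₀ hs W hpos N ρ hC⟩
    refine h p hp e he K s₀ hs W hpos N 0 fun t ht => ?_
    obtain ⟨hr, ho⟩ := hB t ht
    refine ⟨?_, ?_, by rw [hr, map_zero]⟩
    · rintro ⟨i, -, -, hri⟩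
      rw [hr] at hri
      exact absurd hri (by simp)
    · rw [shade_eq_of_ordZero_eq _ ho, hr, map_zero, Nat.sub_zero]
  · rintro ⟨hB, hL⟩ p hp e he K _ _ _ _ s₀ hs W hpos N ρ hC
    rcases Nat.eq_zero_or_pos ρ with hρ | hρ
    · subst hρ
      refine hB p hp e he K s₀ hs W hpos N fun t ht => ?_
      obtain ⟨-, hsh, hdeg⟩ := hC t ht
      have hr : (W.st t).r = 0 := (Finsupp.degree_eq_zero_iff _).mp hdeg
      refine ⟨hr, ?_⟩
      obtain ⟨o, ho, -⟩ := walk_nat hs W t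
      obtain ⟨s, hs', hos⟩ := order_eq_shade_add_degree hs W t ho
      rw [hdeg, add_zero] at hos
      rw [ho, hos, ← hs', hsh]
    · exact hL p hp e he K s₀ hs W hpos N ρ hρ hC

/-! ### Position relative to g10's itinerary cut (both PROVED): the 2 × 2 grid -/

/-- The jump half of g10 lies INSIDE the satellite column: `SatDefectWalksTerminateDeep → NoRecurrentJumpWalksDeep`
(every jump is the child of a satellite move). [folklore] -/
theorem noRecurrentJump_of_satDeep (h : SatDefectWalksTerminateDeep) : NoRecurrentJumpWalksDeep :=
  fun p hp e he K _ _ _ _ s₀ hs W hpos hR => h p hp e he K s₀ hs W hpos (satellite_io_of_recurrentJumps hp hs W hR)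

/-- The critical free plateaux are plateaux: `NoPlateauWalksDeep → NoCriticalFreePlateauxDeep`. [folklore] -/
theorem critical_of_noPlateau (h : NoPlateauWalksDeep) : NoCriticalFreePlateauxDeep := by
  intro p hp e he K _ _ _ _ s₀ hs W hpos N ρ hC
  refine h p hp e he K s₀ hs W hpos ⟨N, fun t ht => ?_⟩
  simp only
  rw [(hC (t + 1) (by omega)).2.1, (hC t ht).2.1]

/-- Hence also the mixed exact cut `DefectWalksTerminateDeep ⟺ NoPlateauWalksDeep ∧ SatDefectWalksTerminateDeep`
(PROVED) — the residual is the SATELLITE column: satellite plateaux and satellite jump-walks. [folklore] -/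
theorem defectDeep_iff_plateau_sat :
    DefectWalksTerminateDeep ↔ NoPlateauWalksDeep ∧ SatDefectWalksTerminateDeep :=
  ⟨fun h => ⟨noPlateau_of_deep h, satDeep_of_deep h⟩,
    fun h => deep_of_ledger (critical_of_noPlateau h.1) h.2⟩

/-! ## §5 Quantitative ledger laws (all exponents; PROVED) -/

section Laws

variable {p e : ℕ} {K : Type} [Field K] [DecidableEq K] {s₀ : State (Fin 3) K}

/-- One step of the ledger in the form `|r_{t+1}| + q = κ_t + s_t + |r_t|` (ℕ, with `s_t` the shade). [folklore] -/
theorem ledger_step (hroot : IsRoot (p ^ e) s₀) (W : ForcedWalk (p ^ e) s₀) (t : ℕ) :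
    ∃ s : ℕ, (W.st t).shade = (s : ℕ∞) ∧
      (W.st (t + 1)).r.degree + p ^ e = (kept W t).degree + s + (W.st t).r.degree := by
  obtain ⟨o, ho, hqo⟩ := walk_nat hroot W t
  obtain ⟨s, hs, hos⟩ := order_eq_shade_add_degree hroot W t ho
  refine ⟨s, hs, ?_⟩
  have := degree_r_succ W t ho
  omega

/-- **Light boundary along a walk (PROVED from isolation):** every state of a forced walk has total boundary mass
`|r_t| < 2q` (each PAIR of multiplicities sums to `< q`, tree `pair_lt_of_isolatedTop`). [folklore] -/
theorem degree_le_of_walk (hroot : IsRoot (p ^ e) s₀) (W : ForcedWalk (p ^ e) s₀) (t : ℕ) :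
    (W.st t).r.degree < 2 * p ^ e := by
  classical
  have h01 := pair_lt_of_isolatedTop (W.isolated t) (0 : Fin 3) 1 (by decide)
    (X_pow_mul_X_pow_dvd_of_forall_le (walk_r hroot W t) (by decide))
  have h2 : (W.st t).r 2 < p ^ e := by
    have h20 := pair_lt_of_isolatedTop (W.isolated t) (2 : Fin 3) 0 (by decide)
      (X_pow_mul_X_pow_dvd_of_forall_le (walk_r hroot W t) (by decide))
    omega
  have hsum : (W.st t).r.degree = (W.st t).r 0 + (W.st t).r 1 + (W.st t).r 2 := by
    rw [Finsupp.degree_eq_sum, Fin.sum_univ_three]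
  omega

/-- **MEAN REVERSION OF THE SHADE (PROVED).**  In every window of `2·q` consecutive stages of a forced walk (any
exponent `q = pᵉ`) some stage has shade `≤ q`: a run of `T` supercritical stages (`s_t ≥ q + 1`) pushes the
boundary mass up by `≥ T`, and the mass is `< 2q`.  In particular `lim inf s_t ≤ q` on every infinite forced
walk — the infinite walks live at or below the critical shade infinitely often. [folklore]
(Sources: Hauser2010 §D; Moh1987.) -/
theorem exists_shade_le_within (hroot : IsRoot (p ^ e) s₀) (W : ForcedWalk (p ^ e) s₀) (N : ℕ) :
    ∃ t, N ≤ t ∧ t < N + 2 * p ^ e ∧ (W.st t).shade ≤ ((p ^ e : ℕ) : ℕ∞) := by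
  classical
  by_contra hno
  push Not at hno
  -- along the window the mass grows by at least one per step
  have hgrow : ∀ m, m ≤ 2 * p ^ e → m + (W.st N).r.degree ≤ (W.st (N + m)).r.degree := by
    intro m
    induction m with
    | zero => simp
    | succ m ih =>
      intro hm
      obtain ⟨s, hs, hled⟩ := ledger_step hroot W (N + m)
      have hbig : p ^ e + 1 ≤ s := by
        have h1 := hno (N + m) (by omega) (by omega)
        rw [hs] at h1
        have h2 : (p ^ e : ℕ) < s := by exact_mod_cast h1
        omega
      have := ih (by omega)
      rw [show N + (m + 1) = N + m + 1 by omega]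
      omega
  have h1 := hgrow (2 * p ^ e) le_rfl
  have h2 := degree_le_of_walk hroot W (N + 2 * p ^ e)
  omega

/-- **No supercritical tails (PROVED):** no forced walk has shade `≥ q + 1` from some time on. [folklore] -/
theorem not_eventually_supercritical (hroot : IsRoot (p ^ e) s₀) (W : ForcedWalk (p ^ e) s₀) :
    ¬ ∃ N, ∀ t, N ≤ t → ((p ^ e : ℕ) : ℕ∞) < (W.st t).shade := by
  rintro ⟨N, hN⟩
  obtain ⟨t, ht, -, hle⟩ := exists_shade_le_within hroot W N
  exact absurd (hN t ht) (not_lt.mpr hle)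

/-- **FREE-STRETCH LAW (PROVED; the finite, census-checkable form of §3).**  Across two consecutive FREE moves
`t, t+1` of a forced walk at exponent `q = pᵉ`: the shade does not increase from stage `t+1` to `t+2`, both boundary
masses are `< q`, and the mass performs the ledger step `|r_{t+2}| + q = s_{t+1} + |r_{t+1}|`.  Hence on any stretch
of consecutive free moves the shade is non-increasing and its excess over `q` is summed into a quantity confined to
`[0, q)`: free stretches are CRITICAL except for fewer than `q` super- and fewer than `q` sub-critical stages.
(Instrument T-ledger.) [folklore] -/
theorem free_stretch_law [CharP K p] (hp : p.Prime) (hroot : IsRoot (p ^ e) s₀) (W : ForcedWalk (p ^ e) s₀) (t : ℕ)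
    (h0 : ¬ W.Satellite t) (h1 : ¬ W.Satellite (t + 1)) :
    ∃ s : ℕ, (W.st (t + 1)).shade = (s : ℕ∞) ∧
      (W.st (t + 1 + 1)).r.degree + p ^ e = s + (W.st (t + 1)).r.degree ∧
      (W.st (t + 1)).r.degree < p ^ e ∧ (W.st (t + 1 + 1)).r.degree < p ^ e ∧
      (W.st (t + 1 + 1)).shade ≤ (W.st (t + 1)).shade := by
  have hq : 0 < p ^ e := Nat.pos_of_ne_zero (pow_ne_zero e hp.ne_zero)
  obtain ⟨s, hs, hled⟩ := ledger_step hroot W (t + 1)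
  have hk : kept W (t + 1) = 0 := by
    by_contra h
    exact h1 ((satellite_iff_kept_ne_zero W (t + 1)).mpr h)
  rw [hk, map_zero, zero_add] at hled
  refine ⟨s, hs, hled, degree_lt_of_subsingleton W hroot (t + 1) hq (subsingleton_succ_of_not_satellite hroot W t h0),
    degree_lt_of_subsingleton W hroot (t + 1 + 1) hq (subsingleton_succ_of_not_satellite hroot W (t + 1) h1),
    not_lt.mp (not_jump_of_subsingleton hp hroot W (t + 1) (subsingleton_succ_of_not_satellite hroot W t h0))⟩

end Laws

/-! ## §6 The E-format column and ROOT BY NAME -/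

/-- The deep E-format column hangs on the two ledger pieces (+ the dictionary port and the shade-0 walks, PROVED in
g9 / tree `strongWalksTerminate`), through g10's assembly. [folklore] -/
theorem polyPureTowersTerminateDeep_of_ledger (hT : TowerDictionary) (hS : StrongWalksTerminate)
    (h₁ : NoCriticalFreePlateauxDeep) (h₂ : SatDefectWalksTerminateDeep) : PolyPureTowersTerminateDeep :=
  polyPureTowersTerminateDeep_of_itinerary hT hS (noPlateau_of_deep (deep_of_ledger h₁ h₂))
    (noRecurrentJump_of_satDeep h₂)

end Summit.ResolutionOfSingularities.ResolutionOfSingularities.Theorems.BoundaryLedger
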